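import Summits.AnomalousDissipation.AnomalousDissipation.Theorems.QuarticGate.Negative.LevelOne

/-!
# Negative knowledge for the crux `MomentParity.QuarticGate` (stmt-AnomalousDissipation-11464):
# level one is inert, II — `QuadRigidity 1` fails (a quadratic Casimir that is not `αE + βH`)

(cdisprove g2, cycle 2; continuation of `LevelOne.lean`.) A second laminar family
`K'_a = a cos(2πx₂) e₀`, `L²`-orthogonal to `K_a = a cos(2πx₁) e₀`, and the refutation of conjunct (ii)
of the lead's `stub_casimirs` at `N = 1`: the Casimir `(u, K_1)²` has gradient `2(u,K_1)K_1`, which is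
not `2α P_1 u + 2β curl P_1 u` (test at `u = [K_1]`, where `K ⊥ curl K` pointwise forces `α = 1/2`, then
at `u = [K'_1]`).
-/

namespace Summit.AnomalousDissipation.AnomalousDissipation.Theorems.QuarticGate.Negative

open MeasureTheory Filter Topology
open scoped ENNReal InnerProductSpace RealInnerProductSpace
open Literature.Analysis.FunctionSpaces Literature.Analysis.FluidPDE
open Summit.AnomalousDissipation.AnomalousDissipation.Theses.MomentParity

-- `Summit.<Summit>.<Problem>` is the tree's mandated summit-side namespace (CONVENTIONS §2); for this
-- single-conjunct summit the two coincide, so the duplicate is deliberate.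
set_option linter.dupNamespace false

noncomputable section

/-! ## A second laminar family `K'_a = a cos(2πx₂) e₀` (frequency `e₂`, polarisation `e₀`) -/

section LaminarTwo

/-- The frequency `e₂ = (0,0,1)`. -/
def kolFreq₂ : Fin 3 → ℤ := Pi.single 2 1

/-- The symmetric frequency pair `{e₂, −e₂}`. -/
def kolSet₂ : Finset (Fin 3 → ℤ) := {kolFreq₂, -kolFreq₂}

/-- The second laminar field `K'_a(x) = a cos(2πx₂) e₀`. -/
def kolField₂ (a : ℝ) : UnitAddTorus (Fin 3) → EuclideanSpace ℝ (Fin 3) :=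
  Torus.realTrigPoly kolSet₂ (kolCoeff a)

/-- Bookkeeping for the second laminar family. [folklore] -/
theorem kolFreq₂_ne_zero : kolFreq₂ ≠ 0 := fun h => by
  have := congrFun h 2; simp [kolFreq₂] at this

/-- Bookkeeping for the second laminar family. [folklore] -/
theorem freqNormSq_kolFreq₂ : Torus.freqNormSq kolFreq₂ = 1 := by
  simp [Torus.freqNormSq, kolFreq₂, Fin.sum_univ_three]

/-- Bookkeeping for the second laminar family. [folklore] -/
theorem neg_mem_kolSet₂ : ∀ k ∈ kolSet₂, -k ∈ kolSet₂ := by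
  intro k hk
  simp only [kolSet₂, Finset.mem_insert, Finset.mem_singleton] at hk ⊢
  rcases hk with rfl | rfl <;> simp

/-- Bookkeeping for the second laminar family. [folklore] -/
theorem freqNormSq_of_mem_kolSet₂ {k : Fin 3 → ℤ} (hk : k ∈ kolSet₂) : Torus.freqNormSq k = 1 := by
  simp only [kolSet₂, Finset.mem_insert, Finset.mem_singleton] at hk
  rcases hk with rfl | rfl
  · exact freqNormSq_kolFreq₂
  · rw [Torus.freqNormSq_neg]; exact freqNormSq_kolFreq₂

/-- Bookkeeping for the second laminar family. [folklore] -/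
theorem ne_zero_of_mem_kolSet₂ {k : Fin 3 → ℤ} (hk : k ∈ kolSet₂) : k ≠ 0 := by
  intro h; subst h
  have := freqNormSq_of_mem_kolSet₂ hk
  rw [Torus.freqNormSq_zero] at this
  exact zero_ne_one this

/-- Bookkeeping for the second laminar family. [folklore] -/
theorem apply_zero_of_mem_kolSet₂ {k : Fin 3 → ℤ} (hk : k ∈ kolSet₂) : k 0 = 0 := by
  simp only [kolSet₂, Finset.mem_insert, Finset.mem_singleton] at hk
  rcases hk with rfl | rfl <;> simp [kolFreq₂]

/-- Bookkeeping for the second laminar family. [folklore] -/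
theorem isTransversal_kolCoeff₂ (a : ℝ) : Torus.IsTransversal kolSet₂ (kolCoeff a) := by
  intro k hk
  simp [kolCoeff, EuclideanSpace.complexify_apply, Fin.sum_univ_three, apply_zero_of_mem_kolSet₂ hk]

/-- `K'_a` is smooth. [folklore] -/
theorem isSmooth_kolField₂ (a : ℝ) : Torus.IsSmooth (kolField₂ a) :=
  Torus.isSmooth_realTrigPoly _ _

/-- `K'_a` is divergence free. [folklore] -/
theorem isDivFree_kolField₂ (a : ℝ) : Torus.IsDivFree (kolField₂ a) :=
  Torus.isDivFree_realTrigPoly (isTransversal_kolCoeff₂ a)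

/-- `K'_a` has zero mean. [folklore] -/
theorem hasZeroMean_kolField₂ (a : ℝ) : Torus.HasZeroMean (kolField₂ a) := by
  unfold Torus.HasZeroMean kolField₂
  simp_rw [Torus.realTrigPoly_apply_eq_sum]
  rw [integral_finsetSum _ fun k _ => ?_]
  · refine Finset.sum_eq_zero fun k hk => ?_
    have hi : Integrable (fun x : UnitAddTorus (Fin 3) => UnitAddTorus.mFourier k x • kolCoeff a k) volume :=
      ((UnitAddTorus.mFourier k).continuous.smul continuous_const).integrable_unitAddTorus
    rw [ContinuousLinearMap.integral_comp_comm _ hi, integral_smul_const, Torus.integral_mFourier,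
      if_neg (ne_zero_of_mem_kolSet₂ hk), zero_smul, map_zero]
  · exact (EuclideanSpace.realPart.continuous.comp
      ((UnitAddTorus.mFourier k).continuous.smul continuous_const)).integrable_unitAddTorus

/-- Bookkeeping for the second laminar family. [folklore] -/
theorem kolFreq₂_ne_neg : kolFreq₂ ≠ -kolFreq₂ := fun h => by
  have := congrFun h 2; simp [kolFreq₂] at this

/-- Bookkeeping for the second laminar family. [folklore] -/
theorem card_kolSet₂ : kolSet₂.card = 2 := by
  rw [kolSet₂, Finset.card_insert_of_notMem (by simpa using kolFreq₂_ne_neg), Finset.card_singleton]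

/-- `∫ ‖K'_a‖² = a²/2`. [folklore] -/
theorem integral_norm_sq_kolField₂ (a : ℝ) : ∫ x, ‖kolField₂ a x‖ ^ 2 = a ^ 2 / 2 := by
  rw [kolField₂, Torus.integral_norm_sq_realTrigPoly neg_mem_kolSet₂ (isConjSymm_kolCoeff a),
    Finset.sum_congr rfl fun k _ => by rw [norm_kolCoeff], Finset.sum_const, card_kolSet₂]
  simp only [nsmul_eq_mul, Nat.cast_ofNat, div_pow, sq_abs]
  ring

/-- The class of `K'_a` in `H`. -/
def kolState₂ (a : ℝ) : Torus.energySpace (Fin 3) :=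
  ⟨((isSmooth_kolField₂ a).memLp 2).toLp (kolField₂ a),
    Torus.smoothSolenoidal_subset_energySpace ⟨kolField₂ a, isSmooth_kolField₂ a,
      isDivFree_kolField₂ a, hasZeroMean_kolField₂ a, MemLp.coeFn_toLp _⟩⟩

/-- Bookkeeping for the second laminar family. [folklore] -/
theorem coe_kolState₂_ae (a : ℝ) :
    (((kolState₂ a).1 : (Lp (EuclideanSpace ℝ (Fin 3)) 2 (volume : Measure (UnitAddTorus (Fin 3))))) : UnitAddTorus (Fin 3) → EuclideanSpace ℝ (Fin 3)) =ᵐ[volume] kolField₂ a :=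
  MemLp.coeFn_toLp ((isSmooth_kolField₂ a).memLp 2)

/-- `K'_a` is a level-`1` field. [folklore] -/
theorem isLevel_kolState₂ (a : ℝ) {N : ℕ} (hN : 1 ≤ N) : IsLevel N (kolState₂ a) := by
  intro k hk
  rw [mFourierCoeff_congr_ae (coe_kolState₂_ae a), kolField₂]
  have hk' : k ∉ kolSet₂ := fun hkS => hk (Finset.mem_erase.2 ⟨ne_zero_of_mem_kolSet₂ hkS,
    Torus.mem_freqBall.2 (by
      rw [freqNormSq_of_mem_kolSet₂ hkS]
      have : (1 : ℝ) ≤ N := by exact_mod_cast hN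
      nlinarith)⟩)
  have hnk' : -k ∉ kolSet₂ := fun h => hk' (by simpa using neg_mem_kolSet₂ _ h)
  exact Torus.mFourierCoeff_realTrigPoly_eq_zero_of_not_mem _ hk' hnk'

/-- The two laminar families are `L²`-orthogonal: `([K'_a], K_b) = 0` (disjoint frequency supports). [folklore] -/
theorem pairing_kolState₂_kolField (a b : ℝ) :
    Torus.pairing ((kolState₂ a).1 : (Lp (EuclideanSpace ℝ (Fin 3)) 2 (volume : Measure (UnitAddTorus (Fin 3))))) (kolField b) = 0 := by
  unfold Torus.pairing
  rw [integral_congr_ae ((coe_kolState₂_ae a).mono fun x hx =>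
    show ⟪(((kolState₂ a).1 : (Lp (EuclideanSpace ℝ (Fin 3)) 2 (volume : Measure (UnitAddTorus (Fin 3))))) : UnitAddTorus (Fin 3) → EuclideanSpace ℝ (Fin 3)) x, kolField b x⟫_ℝ =
      ⟪kolField₂ a x, kolField b x⟫_ℝ by rw [hx])]
  rw [kolField₂, Torus.integral_inner_realTrigPoly_left neg_mem_kolSet₂ (isConjSymm_kolCoeff a)
    ((isSmooth_kolField b).memLp 2)]
  refine Finset.sum_eq_zero fun k hk => ?_
  have h1 : k ∉ kolSet := by
    simp only [kolSet₂, Finset.mem_insert, Finset.mem_singleton] at hk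
    simp only [kolSet, Finset.mem_insert, Finset.mem_singleton, not_or]
    rcases hk with rfl | rfl <;>
      exact ⟨fun h => by have := congrFun h 2; simp [kolFreq, kolFreq₂] at this,
        fun h => by have := congrFun h 2; simp [kolFreq, kolFreq₂] at this⟩
  have h2 : -k ∉ kolSet := fun h => h1 (by simpa using neg_mem_kolSet _ h)
  rw [kolField, Torus.mFourierCoeff_realTrigPoly_eq_zero_of_not_mem _ h1 h2, inner_zero_right,
    Complex.zero_re]

end LaminarTwo

/-! ## S2 (ii) fails at level one: a quadratic Casimir that is not `αE + βH` -/

section Quad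

/-- Conjunct (ii) of the lead's `stub_casimirs` at level `N` (verbatim): QuadRigidity — every
homogeneous quadratic Casimir of level-`N` Galerkin–Euler has gradient `2α P_N u + 2β curl P_N u`. -/
def QuadRigidity (N : ℕ) : Prop :=
  ∀ (m : ℕ) (g : Fin m → UnitAddTorus (Fin 3) → EuclideanSpace ℝ (Fin 3))
    (P : MvPolynomial (Fin m) ℝ), (∀ i, IsBandTest N (g i)) → P.IsHomogeneous 2 →
    (∀ u : Torus.energySpace (Fin 3), IsLevel N u →
      Torus.nsGeneratorPairing (d := Fin 3) 0 0 u (polyGrad g P u) = 0) →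
    ∃ α β : ℝ, ∀ u : Torus.energySpace (Fin 3), IsLevel N u →
      ∀ x, polyGrad g P u x =
        (2 * α) • Torus.fourierTruncate N (u.1 : UnitAddTorus (Fin 3) → EuclideanSpace ℝ (Fin 3)) x +
        (2 * β) • BDSV.curl (Torus.fourierTruncate N
          (u.1 : UnitAddTorus (Fin 3) → EuclideanSpace ℝ (Fin 3))) x

/-- The differential of the quadratic observable `(u, K)²`: `∇p(u) = 2(u,K) K`. [folklore] -/
theorem polyGrad_X_sq (K : UnitAddTorus (Fin 3) → EuclideanSpace ℝ (Fin 3))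
    (u : Torus.energySpace (Fin 3)) (x : UnitAddTorus (Fin 3)) :
    polyGrad (fun _ : Fin 1 => K) (MvPolynomial.X 0 ^ 2) u x = (2 * Torus.pairing u.1 K) • K x := by
  simp [polyGrad, Derivation.leibniz_pow, MvPolynomial.pderiv_X]

/-- The truncation of a state's representative is the field: `P_N [F] = F` for a smooth field `F`
band-limited to the ball and a.e. equal to the representative. [folklore] -/
theorem fourierTruncate_coe_eq {N : ℕ} {u : Torus.energySpace (Fin 3)}
    {F : UnitAddTorus (Fin 3) → EuclideanSpace ℝ (Fin 3)} (hF : Torus.IsSmooth F)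
    (hae : ((u.1 : (Lp (EuclideanSpace ℝ (Fin 3)) 2 (volume : Measure (UnitAddTorus (Fin 3))))) : UnitAddTorus (Fin 3) → EuclideanSpace ℝ (Fin 3)) =ᵐ[volume] F)
    (hu : IsLevel N u) :
    Torus.fourierTruncate N ((u.1 : (Lp (EuclideanSpace ℝ (Fin 3)) 2 (volume : Measure (UnitAddTorus (Fin 3))))) : UnitAddTorus (Fin 3) → EuclideanSpace ℝ (Fin 3)) = F := by
  have hcoe : (fun k => UnitAddTorus.mFourierCoeff (EuclideanSpace.complexify ∘
      ((u.1 : (Lp (EuclideanSpace ℝ (Fin 3)) 2 (volume : Measure (UnitAddTorus (Fin 3))))) : UnitAddTorus (Fin 3) → EuclideanSpace ℝ (Fin 3))) k) = fun k => tcoef F k :=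
    funext fun k => mFourierCoeff_congr_ae hae k
  rw [Torus.fourierTruncate_eq, hcoe]
  change Torus.fourierTruncate N F = F
  refine Torus.fourierTruncate_eq_self hF.continuous fun k hk => ?_
  have h := hu k (fun h => (Torus.not_mem_freqBall.2 hk) (Finset.mem_of_mem_erase h))
  rwa [mFourierCoeff_congr_ae hae] at h

/-- The components `i ≠ 0` of `realTrigPoly S (kolCoeff a)` vanish (polarisation `e₀`). [folklore] -/
theorem realTrigPoly_kolCoeff_apply_of_ne (S : Finset (Fin 3 → ℤ)) (a : ℝ) (x : UnitAddTorus (Fin 3))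
    {i : Fin 3} (hi : i ≠ 0) : Torus.realTrigPoly S (kolCoeff a) x i = 0 := by
  rw [Torus.realTrigPoly_apply_coord, Torus.trigPoly_apply]
  simp [kolCoeff, EuclideanSpace.complexify_apply, hi.symm]

/-- The components `i ≠ 0` of every partial derivative of `realTrigPoly S (kolCoeff a)` vanish. [folklore] -/
theorem partialDeriv_realTrigPoly_kolCoeff_apply_of_ne (S : Finset (Fin 3 → ℤ)) (a : ℝ) (j : Fin 3)
    (x : UnitAddTorus (Fin 3)) {i : Fin 3} (hi : i ≠ 0) :
    Torus.partialDeriv j (Torus.realTrigPoly S (kolCoeff a)) x i = 0 := by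
  rw [Torus.partialDeriv_realTrigPoly, Torus.realTrigPoly_apply_coord, Torus.trigPoly_apply]
  simp [kolCoeff, EuclideanSpace.complexify_apply, hi.symm]

/-- The `e₀`-polarised laminar fields are pointwise orthogonal to their curl:
`⟪F(x), curl F(x)⟫ = 0` for `F = realTrigPoly S (kolCoeff a)`. [folklore] -/
theorem inner_curl_realTrigPoly_kolCoeff (S : Finset (Fin 3 → ℤ)) (a : ℝ) (x : UnitAddTorus (Fin 3)) :
    ⟪Torus.realTrigPoly S (kolCoeff a) x, BDSV.curl (Torus.realTrigPoly S (kolCoeff a)) x⟫_ℝ = 0 := by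
  obtain ⟨h0, -, -⟩ := IntermittentBeltrami.curl_apply_fin (Torus.realTrigPoly S (kolCoeff a)) x
  have hc0 : BDSV.curl (Torus.realTrigPoly S (kolCoeff a)) x 0 = 0 := by
    rw [h0, partialDeriv_realTrigPoly_kolCoeff_apply_of_ne S a 1 x (by decide),
      partialDeriv_realTrigPoly_kolCoeff_apply_of_ne S a 2 x (by decide), sub_zero]
  simp [PiLp.inner_apply, Fin.sum_univ_three, hc0,
    realTrigPoly_kolCoeff_apply_of_ne S a x (i := 1) (by decide),
    realTrigPoly_kolCoeff_apply_of_ne S a x (i := 2) (by decide)]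

/-- A field with `∫‖F‖² ≠ 0` is nonzero somewhere. [folklore] -/
theorem exists_ne_zero_of_integral_norm_sq_ne_zero {F : UnitAddTorus (Fin 3) → EuclideanSpace ℝ (Fin 3)}
    (h : ∫ x, ‖F x‖ ^ 2 ≠ 0) : ∃ x, F x ≠ 0 := by
  by_contra hF
  push Not at hF
  exact h (by simp [hF])

/-- **`¬ QuadRigidity 1`**: the quadratic Casimir `(u, K_1)²` of level-`1` Galerkin–Euler
(everything is a Casimir there) has gradient `2(u,K_1)K_1`, which is not of the form
`2α P_1 u + 2β curl P_1 u`: at `u = [K_1]` pointwise orthogonality `K ⊥ curl K` forces `α = 1/2`,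
and then at the orthogonal level-`1` state `u = [K'_1]` (`K' = cos(2πx₂)e₀`) the identity reads
`0 = K' + 2β curl K'`, impossible as `K' ⊥ curl K'` pointwise and `K' ≢ 0`. The "`∀ N ≥ 1`"
strengthening of conjunct (ii) of `stub_casimirs` is false. [folklore] -/
theorem not_quadRigidity_one : ¬ QuadRigidity 1 := by
  intro h
  obtain ⟨α, β, hαβ⟩ := h 1 (fun _ => kolField 1) (MvPolynomial.X 0 ^ 2)
    (fun _ => isBandTest_kolField 1) ((MvPolynomial.isHomogeneous_X ℝ (0 : Fin 1)).pow 2)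
    (fun u hu => euler_bracket_polyGrad_eq_zero_of_level_one _ _ (fun _ => isBandTest_kolField 1) u hu)
  have h0 := hαβ (kolState 1) (isLevel_kolState 1 le_rfl)
  have h1 := hαβ (kolState₂ 1) (isLevel_kolState₂ 1 le_rfl)
  simp only [polyGrad_X_sq, pairing_kolState_kolField, pairing_kolState₂_kolField,
    fourierTruncate_coe_eq (isSmooth_kolField 1) (coe_kolState_ae 1) (isLevel_kolState 1 le_rfl),
    fourierTruncate_coe_eq (isSmooth_kolField₂ 1) (coe_kolState₂_ae 1) (isLevel_kolState₂ 1 le_rfl)]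
    at h0 h1
  -- Step 1: `α = 1/2` from `u = [K_1]`, pairing the identity with `K_1(x₀)` where `K_1(x₀) ≠ 0`
  obtain ⟨x₀, hx₀⟩ := exists_ne_zero_of_integral_norm_sq_ne_zero (F := kolField 1)
    (by rw [integral_norm_sq_kolField]; norm_num)
  have hα : α = 1 / 2 := by
    have e := congrArg (fun v => ⟪kolField 1 x₀, v⟫_ℝ) (h0 x₀)
    simp only [inner_add_right, inner_smul_right, real_inner_self_eq_norm_sq] at e
    rw [kolField, inner_curl_realTrigPoly_kolCoeff, ← kolField] at e
    have hn : ‖kolField 1 x₀‖ ^ 2 ≠ 0 := by positivity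
    have e' : (1 - 2 * α) * ‖kolField 1 x₀‖ ^ 2 = 0 := by nlinarith [e]
    rcases mul_eq_zero.1 e' with h' | h'
    · linarith
    · exact absurd h' hn
  -- Step 2: at `u = [K'_1]` the identity forces `K'_1 ≡ 0`
  obtain ⟨x₁, hx₁⟩ := exists_ne_zero_of_integral_norm_sq_ne_zero (F := kolField₂ 1)
    (by rw [integral_norm_sq_kolField₂]; norm_num)
  have e := congrArg (fun v => ⟪kolField₂ 1 x₁, v⟫_ℝ) (h1 x₁)
  simp only [inner_add_right, inner_smul_right, real_inner_self_eq_norm_sq] at e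
  rw [kolField₂, inner_curl_realTrigPoly_kolCoeff, ← kolField₂, hα] at e
  have hn : ‖kolField₂ 1 x₁‖ ^ 2 ≠ 0 := by positivity
  apply hn
  nlinarith [e]

end Quad

end

end Summit.AnomalousDissipation.AnomalousDissipation.Theorems.QuarticGate.Negative
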